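import Mathlib

/-!
# Crux `WordLengthQP` (stmt-ValiantsHypothesis-6623), line `positive-monoid-exits` —
helpers for stub `stub_kappaTwoStructure` (rung 2, the `κ = 2` structure theorem), part 1:
letters, `S`-conjugation, coefficientwise bookkeeping, splitting a word at its exits, the
`≤ 1`-wild-letter lemma and the eight dead placements.

A letter is `l = (i, j, c, o) : Fin 3 × Fin 3 × ℝ × Option σ` with matrix
`(Matrix.transvection (Prod.fst l) (Prod.fst (Prod.snd l)) (MvPolynomial.C (Prod.fst (Prod.snd (Prod.snd l))) * Option.elim (Prod.snd (Prod.snd (Prod.snd l))) 1 MvPolynomial.X) : Matrix (Fin 3) (Fin 3) (MvPolynomial σ ℝ)) = Matrix.transvection i j (C c * o.elim 1 X)`; an EXIT is a letter that is not (positive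
coefficient and adjacent); a WILD letter is an exit with `c ≠ 0` (negative adjacent, or far);
the other letters are TAME (positive adjacent, or `c = 0` i.e. the identity matrix).  For a tame
letter `T`: `T S T = S` (`S = diag(1,-1,1)`) and `T - 1` is coefficientwise nonnegative.

* `k2_le_one_wild_absurd`: a word with at most one wild letter never computes `E₀₂(F)` when `F`
  has a monomial of degree `≥ 2` with positive coefficient (rung-1 argument, general `F`).
* `k2_two_wild_identity`: with exactly two wild letters, `w = P₀ ℓ₁ Q ℓ₂ P₂` gives
  `(S ℓ₁ S)(S Q S)(S ℓ₂ S) = P₀ʳᵉᵛ E₀₂(F) P₂ʳᵉᵛ =: M`, `M` coefficientwise `≥ E₀₂(F) ≥ 0`.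
* `k2_placement`: if `F ≥ 0` has a monomial of degree `≥ 3` then the two wild letters sit in
  row `1` / column `1`: `ℓ₁ = E_{1b}(c₁u₁)`, `ℓ₂ = E_{c1}(c₂u₂)` with `c₁, c₂ < 0` (the `(1,1)` family);
  every other placement dies because an adjacent position outside (row of `ℓ₁`) ∪ (column of `ℓ₂`)
  forces `Q` into a submonoid whose conjugated `(0,2)` entry has total degree `≤ 2`.
References (background only): [FallatJohnson2011] Thm 1.1.1/1.3.3; [BenOrCleve1992].
-/

set_option linter.dupNamespace false

noncomputable section

namespace Summit.ValiantsHypothesis.ValiantsHypothesis.Cruxes.WordLengthQP.PositiveMonoidExits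

open MvPolynomial

/-! ## Letters -/


/-- A non-wild (tame) letter is positive adjacent or has coefficient `0`. [folklore] -/
theorem k2_tame_cases {σ : Type} (l : Fin 3 × Fin 3 × ℝ × Option σ) (h : decide (¬ (0 < Prod.fst (Prod.snd (Prod.snd l)) ∧ (Fin.val (Prod.fst l) + 1 = Fin.val (Prod.fst (Prod.snd l)) ∨ Fin.val (Prod.fst (Prod.snd l)) + 1 = Fin.val (Prod.fst l))) ∧ Prod.fst (Prod.snd (Prod.snd l)) ≠ 0) = false) :
    ((0 < Prod.fst (Prod.snd (Prod.snd l)) ∧ (Fin.val (Prod.fst l) + 1 = Fin.val (Prod.fst (Prod.snd l)) ∨ Fin.val (Prod.fst (Prod.snd l)) + 1 = Fin.val (Prod.fst l))) ∨ Prod.fst (Prod.snd (Prod.snd l)) = 0) := by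
  simp only [decide_eq_false_iff_not] at h
  by_cases h1 : 0 < l.2.2.1 ∧ (Fin.val (Prod.fst l) + 1 = Fin.val (Prod.fst (Prod.snd l)) ∨ Fin.val (Prod.fst (Prod.snd l)) + 1 = Fin.val (Prod.fst l))
  · exact Or.inl h1
  · right
    by_contra h0
    exact h ⟨h1, h0⟩

/-- A wild letter is an exit. [folklore] -/
theorem k2_ex_of_wd {σ : Type} (l : Fin 3 × Fin 3 × ℝ × Option σ) (h : decide (¬ (0 < Prod.fst (Prod.snd (Prod.snd l)) ∧ (Fin.val (Prod.fst l) + 1 = Fin.val (Prod.fst (Prod.snd l)) ∨ Fin.val (Prod.fst (Prod.snd l)) + 1 = Fin.val (Prod.fst l))) ∧ Prod.fst (Prod.snd (Prod.snd l)) ≠ 0) = true) :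
    (!decide (0 < l.2.2.1 ∧ (Fin.val (Prod.fst l) + 1 = Fin.val (Prod.fst (Prod.snd l)) ∨ Fin.val (Prod.fst (Prod.snd l)) + 1 = Fin.val (Prod.fst l)))) = true := by
  simp only [decide_eq_true_eq] at h
  simp only [Bool.not_eq_true', decide_eq_false_iff_not]
  exact h.1

/-- Filtering by a stronger predicate gives a shorter list. [folklore] -/
theorem k2_length_filter_mono {α : Type} (f g : α → Bool) (h : ∀ x, f x = true → g x = true)
    (l : List α) : (l.filter f).length ≤ (l.filter g).length := by
  induction l with
  | nil => simp
  | cons a t ih =>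
    simp only [List.filter_cons]
    by_cases hf : f a = true
    · rw [if_pos hf, if_pos (h a hf)]; simpa using ih
    · rw [if_neg hf]
      split_ifs
      · simp only [List.length_cons]; omega
      · exact ih

/-! ## `S`-conjugation -/

/-- `S² = 1`. [folklore] -/
theorem k2_S_mul_S {R : Type*} [CommRing R] :
    Matrix.diagonal ![(1 : R), -1, 1] * Matrix.diagonal ![(1 : R), -1, 1] = 1 := by
  ext i j
  fin_cases i <;> fin_cases j <;> simp

/-- For an adjacent transvection `T` (any coefficient), `T S T = S`.
(adapted from …StubKappaGeTwo.lean) [folklore] -/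
theorem k2_adj_mul_S_mul_adj {R : Type*} [CommRing R] (i j : Fin 3)
    (hij : i.val + 1 = j.val ∨ j.val + 1 = i.val) (a : R) :
    Matrix.transvection i j a * Matrix.diagonal ![(1 : R), -1, 1] * Matrix.transvection i j a =
      Matrix.diagonal ![(1 : R), -1, 1] := by
  fin_cases i <;> fin_cases j <;> simp at hij <;>
  · ext k l
    fin_cases k <;> fin_cases l <;>
      simp [Matrix.transvection, Matrix.mul_apply, Fin.sum_univ_three, Matrix.one_apply]

/-- `S E₀₂(f) S = E₀₂(f)`. (adapted from …StubKappaGeTwo.lean) [folklore] -/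
theorem k2_S_mul_far_mul_S {R : Type*} [CommRing R] (f : R) :
    Matrix.diagonal ![(1 : R), -1, 1] * Matrix.transvection (0 : Fin 3) 2 f *
      Matrix.diagonal ![(1 : R), -1, 1] = Matrix.transvection (0 : Fin 3) 2 f := by
  ext k l
  fin_cases k <;> fin_cases l <;>
    simp [Matrix.transvection, Matrix.mul_apply, Fin.sum_univ_three, Matrix.one_apply]

/-- `S E_ij(a) S = E_ij(± a)` with sign `-` exactly for adjacent `(i, j)`. [folklore] -/
theorem k2_S_T_S {R : Type*} [CommRing R] (i j : Fin 3) (a : R) :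
    Matrix.diagonal ![(1 : R), -1, 1] * Matrix.transvection i j a * Matrix.diagonal ![(1 : R), -1, 1] =
      Matrix.transvection i j
        (if i.val + 1 = j.val ∨ j.val + 1 = i.val then -a else a) := by
  fin_cases i <;> fin_cases j <;>
  · ext k l
    fin_cases k <;> fin_cases l <;>
      simp [Matrix.transvection, Matrix.mul_apply, Fin.sum_univ_three, Matrix.one_apply]

/-- Entries of `S X S`: `(S X S) i j = S i i * X i j * S j j`. [folklore] -/
theorem k2_SXS_apply {R : Type*} [CommRing R] (X : Matrix (Fin 3) (Fin 3) R) (i j : Fin 3) :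
    (Matrix.diagonal ![(1 : R), -1, 1] * X * Matrix.diagonal ![(1 : R), -1, 1]) i j =
      ![(1 : R), -1, 1] i * X i j * ![(1 : R), -1, 1] j := by
  simp [Matrix.mul_apply, Matrix.diagonal]

/-- In a monoid: if every `T` in a list satisfies `T S T = S`, then
`(∏ Ts) S (∏ Ts.reverse) = S` and `(∏ Ts.reverse) S (∏ Ts) = S`.
(adapted from …StubKappaGeTwo.lean) [folklore] -/
theorem k2_prod_mul_S_mul_rev {M : Type*} [Monoid M] (S : M) (Ts : List M)
    (h : ∀ T ∈ Ts, T * S * T = S) :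
    Ts.prod * S * Ts.reverse.prod = S ∧ Ts.reverse.prod * S * Ts.prod = S := by
  induction Ts with
  | nil => simp
  | cons T Ts ih =>
    have hT := h T (by simp)
    obtain ⟨ih1, ih2⟩ := ih (fun U hU => h U (by simp [hU]))
    simp only [List.prod_cons, List.reverse_cons, List.prod_append, List.prod_nil, mul_one]
    constructor
    · calc T * Ts.prod * S * (Ts.reverse.prod * T)
          = T * (Ts.prod * S * Ts.reverse.prod) * T := by simp only [mul_assoc]
        _ = S := by rw [ih1, hT]
    · calc Ts.reverse.prod * T * S * (T * Ts.prod)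
          = Ts.reverse.prod * (T * S * T) * Ts.prod := by simp only [mul_assoc]
        _ = S := by rw [hT, ih2]

/-- A tame letter satisfies `T S T = S`. [folklore] -/
theorem k2_tame_mul_S_mul {σ : Type} (l : Fin 3 × Fin 3 × ℝ × Option σ) (h : ((0 < Prod.fst (Prod.snd (Prod.snd l)) ∧ (Fin.val (Prod.fst l) + 1 = Fin.val (Prod.fst (Prod.snd l)) ∨ Fin.val (Prod.fst (Prod.snd l)) + 1 = Fin.val (Prod.fst l))) ∨ Prod.fst (Prod.snd (Prod.snd l)) = 0)) :
    (Matrix.transvection (Prod.fst l) (Prod.fst (Prod.snd l)) (MvPolynomial.C (Prod.fst (Prod.snd (Prod.snd l))) * Option.elim (Prod.snd (Prod.snd (Prod.snd l))) 1 MvPolynomial.X) : Matrix (Fin 3) (Fin 3) (MvPolynomial σ ℝ)) * Matrix.diagonal ![(1 : MvPolynomial σ ℝ), -1, 1] * (Matrix.transvection (Prod.fst l) (Prod.fst (Prod.snd l)) (MvPolynomial.C (Prod.fst (Prod.snd (Prod.snd l))) * Option.elim (Prod.snd (Prod.snd (Prod.snd l))) 1 MvPolynomial.X) : Matrix (Fin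 3) (Fin 3) (MvPolynomial σ ℝ)) = Matrix.diagonal ![(1 : MvPolynomial σ ℝ), -1, 1] := by
  rcases h with ⟨-, hadj⟩ | h0
  · exact k2_adj_mul_S_mul_adj _ _ hadj _
  · simp [h0]

/-! ## Coefficientwise nonnegative matrices -/

/-- Products of coefficientwise-nonnegative polynomials are coefficientwise nonnegative. [folklore] -/
theorem k2_coeff_mul_nonneg {σ : Type*} {p q : MvPolynomial σ ℝ}
    (hp : ∀ m, 0 ≤ p.coeff m) (hq : ∀ m, 0 ≤ q.coeff m) (m : σ →₀ ℕ) :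
    0 ≤ (p * q).coeff m := by
  classical
  rw [MvPolynomial.coeff_mul]
  exact Finset.sum_nonneg fun x _ => mul_nonneg (hp _) (hq _)

/-- Products of coefficientwise-nonnegative matrices are coefficientwise nonnegative. [folklore] -/
theorem k2_mat_mul_nonneg {σ : Type*} {M N : Matrix (Fin 3) (Fin 3) (MvPolynomial σ ℝ)}
    (hM : ∀ i j m, 0 ≤ (M i j).coeff m) (hN : ∀ i j m, 0 ≤ (N i j).coeff m)
    (i j : Fin 3) (m : σ →₀ ℕ) : 0 ≤ ((M * N) i j).coeff m := by
  rw [Matrix.mul_apply, MvPolynomial.coeff_sum]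
  exact Finset.sum_nonneg fun k _ => k2_coeff_mul_nonneg (hM i k) (hN k j) m

/-- If `T - 1 ≥ 0` coefficientwise for every `T` in a list then `∏ T - 1 ≥ 0`.
(adapted from …StubKappaGeTwo.lean) [folklore] -/
theorem k2_prod_sub_one_nonneg {σ : Type*}
    (Ts : List (Matrix (Fin 3) (Fin 3) (MvPolynomial σ ℝ)))
    (h : ∀ T ∈ Ts, ∀ i j m, 0 ≤ ((T - 1) i j).coeff m) :
    ∀ i j m, 0 ≤ ((Ts.prod - 1) i j).coeff m := by
  refine List.prod_induction
    (fun T : Matrix (Fin 3) (Fin 3) (MvPolynomial σ ℝ) => ∀ i j m, 0 ≤ ((T - 1) i j).coeff m) ?_ ?_ h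
  · intro A B hA hB i j m
    have hAB : A * B - 1 = (A - 1) * (B - 1) + (A - 1) + (B - 1) := by noncomm_ring
    rw [hAB, Matrix.add_apply, Matrix.add_apply, MvPolynomial.coeff_add, MvPolynomial.coeff_add]
    exact add_nonneg (add_nonneg (k2_mat_mul_nonneg hA hB i j m) (hA i j m)) (hB i j m)
  · intro i j m
    simp

/-- `∏ T - 1` dominates each `T - 1` coefficientwise (all `T - 1 ≥ 0`): a letter of the
product shows up in the product. [folklore] -/
theorem k2_mem_le_prod_sub_one {σ : Type*}
    (Ts : List (Matrix (Fin 3) (Fin 3) (MvPolynomial σ ℝ)))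
    (h : ∀ T ∈ Ts, ∀ i j m, 0 ≤ ((T - 1) i j).coeff m) (T : Matrix (Fin 3) (Fin 3) (MvPolynomial σ ℝ))
    (hT : T ∈ Ts) (i j : Fin 3) (m : σ →₀ ℕ) : ((T - 1) i j).coeff m ≤ ((Ts.prod - 1) i j).coeff m := by
  obtain ⟨A, B, rfl⟩ := List.append_of_mem hT
  have hA := k2_prod_sub_one_nonneg A (fun U hU => h U (by simp [hU]))
  have hB := k2_prod_sub_one_nonneg B (fun U hU => h U (by simp [hU]))
  have hT1 := h T hT
  rw [List.prod_append, List.prod_cons]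
  have hdec : A.prod * (T * B.prod) - 1 = (T - 1) + ((A.prod - 1) * (T - 1) * (B.prod - 1) +
      (A.prod - 1) * (T - 1) + (T - 1) * (B.prod - 1) + (A.prod - 1) * (B.prod - 1) +
      (A.prod - 1) + (B.prod - 1)) := by noncomm_ring
  rw [hdec, Matrix.add_apply, MvPolynomial.coeff_add, le_add_iff_nonneg_right]
  simp only [Matrix.add_apply, MvPolynomial.coeff_add]
  refine add_nonneg (add_nonneg (add_nonneg (add_nonneg (add_nonneg ?_ ?_) ?_) ?_) (hA i j m)) (hB i j m)
  · exact k2_mat_mul_nonneg (k2_mat_mul_nonneg hA hT1) hB i j m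
  · exact k2_mat_mul_nonneg hA hT1 i j m
  · exact k2_mat_mul_nonneg hT1 hB i j m
  · exact k2_mat_mul_nonneg hA hB i j m

/-- The entry `C c * u` of a letter (`u = 1` or `x_v`) with `c ≥ 0` is coefficientwise `≥ 0`. [folklore] -/
theorem k2_coeff_Cu_nonneg {σ : Type} (c : ℝ) (hc : 0 ≤ c) (o : Option σ) (m : σ →₀ ℕ) :
    0 ≤ (C c * o.elim 1 X : MvPolynomial σ ℝ).coeff m := by
  classical
  rw [MvPolynomial.coeff_C_mul]
  refine mul_nonneg hc ?_
  cases o with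
  | none => simp only [Option.elim_none, MvPolynomial.coeff_one]; split_ifs <;> norm_num
  | some v => simp only [Option.elim_some, MvPolynomial.coeff_X]; split_ifs <;> norm_num

/-- A tame letter is `1 +` (coefficientwise nonnegative). [folklore] -/
theorem k2_tame_sub_one_nonneg {σ : Type} (l : Fin 3 × Fin 3 × ℝ × Option σ) (h : ((0 < Prod.fst (Prod.snd (Prod.snd l)) ∧ (Fin.val (Prod.fst l) + 1 = Fin.val (Prod.fst (Prod.snd l)) ∨ Fin.val (Prod.fst (Prod.snd l)) + 1 = Fin.val (Prod.fst l))) ∨ Prod.fst (Prod.snd (Prod.snd l)) = 0))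
    (i' j' : Fin 3) (m : σ →₀ ℕ) : 0 ≤ (((Matrix.transvection (Prod.fst l) (Prod.fst (Prod.snd l)) (MvPolynomial.C (Prod.fst (Prod.snd (Prod.snd l))) * Option.elim (Prod.snd (Prod.snd (Prod.snd l))) 1 MvPolynomial.X) : Matrix (Fin 3) (Fin 3) (MvPolynomial σ ℝ)) - 1) i' j').coeff m := by
  classical
  have hc : 0 ≤ l.2.2.1 := by
    rcases h with ⟨h1, -⟩ | h0
    · exact h1.le
    · exact h0.ge
  simp only [Matrix.transvection, add_sub_cancel_left, Matrix.single_apply]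
  split_ifs
  · exact k2_coeff_Cu_nonneg _ hc _ _
  · simp

/-- The exact off-diagonal entry of a letter: `((Matrix.transvection (Prod.fst l) (Prod.fst (Prod.snd l)) (MvPolynomial.C (Prod.fst (Prod.snd (Prod.snd l))) * Option.elim (Prod.snd (Prod.snd (Prod.snd l))) 1 MvPolynomial.X) : Matrix (Fin 3) (Fin 3) (MvPolynomial σ ℝ)) - 1) i j = C c * u` at `(i, j) = type`,
for a valid letter. [folklore] -/
theorem k2_letter_sub_one_apply_self {σ : Type} (l : Fin 3 × Fin 3 × ℝ × Option σ) :
    ((Matrix.transvection (Prod.fst l) (Prod.fst (Prod.snd l)) (MvPolynomial.C (Prod.fst (Prod.snd (Prod.snd l))) * Option.elim (Prod.snd (Prod.snd (Prod.snd l))) 1 MvPolynomial.X) : Matrix (Fin 3) (Fin 3) (MvPolynomial σ ℝ)) - 1) l.1 l.2.1 = C l.2.2.1 * l.2.2.2.elim 1 X := by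
  simp [Matrix.transvection]

/-- `E₀₂(F)` is coefficientwise nonnegative when `F` is. [folklore] -/
theorem k2_far_nonneg {σ : Type} (F : MvPolynomial σ ℝ) (hpos : ∀ m, 0 ≤ F.coeff m) (i j : Fin 3)
    (m : σ →₀ ℕ) : 0 ≤ ((Matrix.transvection (0 : Fin 3) 2 F) i j).coeff m := by
  classical
  rw [Matrix.transvection, Matrix.add_apply, Matrix.one_apply, Matrix.single_apply,
    MvPolynomial.coeff_add]
  refine add_nonneg ?_ ?_
  · split_ifs
    · rw [MvPolynomial.coeff_one]; split_ifs <;> norm_num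
    · simp
  · split_ifs
    · exact hpos m
    · simp

/-- If `R₀ - 1`, `E`, `R₁ - 1` are coefficientwise nonnegative then `R₀ E R₁ ≥ E` coefficientwise.
(adapted from …StubKappaGeTwo.lean) [folklore] -/
theorem k2_coeff_le_conj {σ : Type*} (R0 E R1 : Matrix (Fin 3) (Fin 3) (MvPolynomial σ ℝ))
    (h0 : ∀ i j m, 0 ≤ ((R0 - 1) i j).coeff m) (hE : ∀ i j m, 0 ≤ (E i j).coeff m)
    (h1 : ∀ i j m, 0 ≤ ((R1 - 1) i j).coeff m) (i j : Fin 3) (m : σ →₀ ℕ) :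
    (E i j).coeff m ≤ ((R0 * E * R1) i j).coeff m := by
  have hdec : R0 * E * R1 = E + ((R0 - 1) * E + E * (R1 - 1) + (R0 - 1) * E * (R1 - 1)) := by
    noncomm_ring
  rw [hdec, Matrix.add_apply, MvPolynomial.coeff_add, le_add_iff_nonneg_right, Matrix.add_apply,
    Matrix.add_apply, MvPolynomial.coeff_add, MvPolynomial.coeff_add]
  exact add_nonneg (add_nonneg (k2_mat_mul_nonneg h0 hE i j m) (k2_mat_mul_nonneg hE h1 i j m))
    (k2_mat_mul_nonneg (k2_mat_mul_nonneg h0 hE) h1 i j m)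

/-- A letter entry `C c * u` has total degree `≤ 1`. [folklore] -/
theorem k2_totalDegree_Cu {σ : Type} (c : ℝ) (o : Option σ) :
    (C c * o.elim 1 X : MvPolynomial σ ℝ).totalDegree ≤ 1 := by
  rw [C_mul']
  refine (totalDegree_smul_le _ _).trans ?_
  cases o with
  | none => simp
  | some v => exact (totalDegree_X (R := ℝ) v).le

/-! ## Splitting a word at its wild letters -/

/-- A list with at most one element satisfying `f` is empty or splits as `p₀ ++ L :: p₁` with no
element of `p₀`, `p₁` satisfying `f`. (adapted from …StubKappaGeTwo.lean) [folklore] -/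
theorem k2_split1 {α : Type*} (f : α → Bool) (w : List α) (hw : (w.filter f).length ≤ 1) :
    w = [] ∨ ∃ (p0 : List α) (L : α) (p1 : List α), w = p0 ++ L :: p1 ∧
      (∀ l ∈ p0, f l = false) ∧ (∀ l ∈ p1, f l = false) := by
  by_cases h : ∃ L ∈ w, f L = true
  · obtain ⟨L, hL, hfL⟩ := h
    obtain ⟨s, t, rfl⟩ := List.append_of_mem hL
    rw [List.filter_append, List.filter_cons_of_pos hfL, List.length_append,
      List.length_cons] at hw
    have hs : (s.filter f).length = 0 := by omega
    have ht : (t.filter f).length = 0 := by omega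
    rw [List.length_eq_zero_iff, List.filter_eq_nil_iff] at hs ht
    exact Or.inr ⟨s, L, t, rfl, fun l hl => by simpa using hs l hl,
      fun l hl => by simpa using ht l hl⟩
  · push Not at h
    rcases w with _ | ⟨L, t⟩
    · exact Or.inl rfl
    · exact Or.inr ⟨[], L, t, rfl, fun l hl => by simp at hl,
        fun l hl => by simpa using h l (List.mem_cons_of_mem _ hl)⟩

/-- A list with exactly two elements satisfying `f` splits as `p₀ ++ L₁ :: (q ++ L₂ :: p₂)` with
`f L₁`, `f L₂` and no element of `p₀`, `q`, `p₂` satisfying `f`. [folklore] -/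
theorem k2_split2 {α : Type*} (f : α → Bool) (w : List α) (hw : (w.filter f).length = 2) :
    ∃ (p0 : List α) (L1 : α) (q : List α) (L2 : α) (p2 : List α),
      w = p0 ++ L1 :: (q ++ L2 :: p2) ∧ f L1 = true ∧ f L2 = true ∧
      (∀ l ∈ p0, f l = false) ∧ (∀ l ∈ q, f l = false) ∧ (∀ l ∈ p2, f l = false) := by
  have h : ∃ L ∈ w, f L = true := by
    by_contra hne
    push Not at hne
    have : w.filter f = [] := List.filter_eq_nil_iff.2 fun l hl => by simpa using hne l hl
    rw [this] at hw; simp at hw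
  obtain ⟨L, hL, hfL⟩ := h
  obtain ⟨s, t, rfl⟩ := List.append_of_mem hL
  rw [List.filter_append, List.filter_cons_of_pos hfL, List.length_append, List.length_cons] at hw
  -- helper: a list with filter-length 1 splits around an `f`-element with `f`-free sides
  have one : ∀ u : List α, (u.filter f).length = 1 →
      ∃ (a : List α) (K : α) (b : List α), u = a ++ K :: b ∧ f K = true ∧
        (∀ l ∈ a, f l = false) ∧ (∀ l ∈ b, f l = false) := by
    intro u hu
    rcases k2_split1 f u hu.le with rfl | ⟨a, K, b, rfl, ha, hb⟩
    · simp at hu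
    · refine ⟨a, K, b, rfl, ?_, ha, hb⟩
      by_contra hK
      have hK' : f K = false := by simpa using hK
      have h0 : ((a ++ K :: b).filter f).length = 0 := by
        rw [List.length_eq_zero_iff, List.filter_eq_nil_iff]
        intro l hl
        simp only [List.mem_append, List.mem_cons] at hl
        rcases hl with hl | rfl | hl
        · simpa using ha l hl
        · simp [hK']
        · simpa using hb l hl
      omega
  by_cases hs : (s.filter f).length = 1
  · have ht : (t.filter f).length = 0 := by omega
    rw [List.length_eq_zero_iff, List.filter_eq_nil_iff] at ht
    obtain ⟨a, K, b, rfl, hK, ha, hb⟩ := one s hs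
    refine ⟨a, K, b, L, t, by simp, hK, hfL, ha, hb, fun l hl => by simpa using ht l hl⟩
  · have hs0 : (s.filter f).length = 0 := by omega
    have ht : (t.filter f).length = 1 := by omega
    rw [List.length_eq_zero_iff, List.filter_eq_nil_iff] at hs0
    obtain ⟨a, K, b, rfl, hK, ha, hb⟩ := one t ht
    exact ⟨s, L, a, K, b, rfl, hfL, hK, fun l hl => by simpa using hs0 l hl, ha, hb⟩

end Summit.ValiantsHypothesis.ValiantsHypothesis.Cruxes.WordLengthQP.PositiveMonoidExits

end
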